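import Mathlib
import Summits.ValiantsHypothesis.ValiantsHypothesis.Theorems.LacunarySymmetroidMatrixDescartesEndInertiaGram
import Summits.ValiantsHypothesis.ValiantsHypothesis.Theorems.LacunarySymmetroidMatrixDescartesInertiaParity

/-!
# `MatrixDescartes` (stmt-ValiantsHypothesis-18050) — THE DRIFT LAW AND THE GRAM PARITY LAW: an arbitrary two-sided
# signed word with non-degenerate middle letter and non-singular diagonal Gram blocks has at least `|Δ|` positive zeros
# counted with multiplicity, and `Z₊ ≡ Δ (mod 2)`, where `Δ = (π(Cₗₗ) − #{σₗ>0}) − (π(Cᵤᵤ) − #{σᵤ>0})`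

HONEST FRAMING.  Cell `pub-symmetroid`, seat `val-sym-mdr-p2` (gen 21); helper file `--supports` the crux
`Theses.LacunarySymmetroid.MatrixDescartes` (OPEN), NO closure claim; companion of `…EndInertiaGram` (end inertias of an
arbitrary word from Gram data), `…InertiaWindow` (the inertia law for root counts `ν(F(b)) ≤ ν(F(a)) + #roots`) and
`…InertiaParity` (the parity law of the inertia walk).  STRUCTURE theorems — LOWER bounds and a congruence for the
positive root count of GENERAL (non-monotone) two-sided words; they are NOT upper bounds and say nothing about the crux in
its window, `stub_twoSided`, `DoorA26` / `DoorA34`, registers, or `VP ≠ VNP`.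

THE THEOREM (`drift_le_card_posRoots`).  `B` real symmetric, `det B ≠ 0`, exponent `e`; upper columns `Uᵤ` (signs
`σᵤ ≠ 0` arbitrary, `δᵤ > e`), lower columns `Uₗ` (`σₗ ≠ 0` arbitrary, `δₗ < e`); `Cᵤᵤ = UᵤᵀB⁻¹Uᵤ` and `Cₗₗ = UₗᵀB⁻¹Uₗ`
NON-SINGULAR.  With `Z₊` the positive zeros of `det(X^eB + Uᵤdiag(σᵤX^{δᵤ})Uᵤᵀ + Uₗdiag(σₗX^{δₗ})Uₗᵀ)` counted with
multiplicity and `Δ = (π(Cₗₗ) − #{σₗ > 0}) − (π(Cᵤᵤ) − #{σᵤ > 0})` (the inertia drift `ν(F(0⁺)) − ν(F(∞))` of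
`…EndInertiaGram`):  `π(Cₗₗ) + #{σᵤ>0} ≤ π(Cᵤᵤ) + #{σₗ>0} + Z₊`,  `π(Cᵤᵤ) + #{σₗ>0} ≤ π(Cₗₗ) + #{σᵤ>0} + Z₊`  (i.e.
`Z₊ ≥ |Δ|`), and `π(Cₗₗ) + #{σᵤ>0} + π(Cᵤᵤ) + #{σₗ>0} + Z₊` is EVEN (i.e. `Z₊ ≡ Δ (mod 2)`).  On the MONOTONE sector
(`σᵤ > 0`, `σₗ < 0`) `Δ = π(Cₗₗ) + ν(Cᵤᵤ)` and the drift law is attained (`…MonotoneExact`); off it, every root beyond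
`|Δ|` comes in PAIRS (revivals).  `oneSided_drift_le_card_posRoots`: no lower columns, arbitrary signs above,
`det C ≠ 0` ⇒ `Z₊ ≥ |π(C) − #{σ > 0}|`, `Z₊ ≡ π(C) + #{σ>0} (mod 2)`.
PROOF.  End inertias and non-singular end scales `a < b` from `…EndInertiaGram`; all positive roots lie in `(a, b)`;
the inertia law for root counts in both indices (`Inertia.pencil_negIndex_le_add_card_roots` / `…posIndex…`) and the parity
law (`Inertia.even_negIndex_add_negIndex_add_card_roots`) on the option-pencil presentation of the word.

[folklore] (Sylvester's law of inertia; intermediate value theorem for the inertia walk).  Axioms `propext`,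
`Classical.choice`, `Quot.sound`.  No definitions.
-/

-- layout Summits/ValiantsHypothesis/ValiantsHypothesis forces the duplicated namespace component
set_option linter.dupNamespace false

namespace Summit.ValiantsHypothesis.ValiantsHypothesis.Theorems.LacunarySymmetroidMatrixDescartes

open Polynomial Matrix Finset
open scoped BigOperators Topology

namespace GramDual

section Drift

variable {ι ρᵤ ρₗ : Type} [Fintype ι] [DecidableEq ι] [Fintype ρᵤ] [DecidableEq ρᵤ] [Fintype ρₗ] [DecidableEq ρₗ]

/-- the signed column part (file-local notation, as in `…GramDualSigned`) -/
local notation3 (prettyPrint := false) "𝕊[" U ", " σ ", " δ "]" =>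
  ((U : Matrix _ _ ℝ).map Polynomial.C
      * Matrix.diagonal (fun j => Polynomial.C ((σ : _ → ℝ) j) * (Polynomial.X : Polynomial ℝ) ^ (δ j : ℕ))
      * ((U : Matrix _ _ ℝ).map Polynomial.C)ᵀ)

/-- **THE DRIFT LAW AND THE GRAM PARITY LAW.**  `B` real symmetric, `det B ≠ 0`, exponent `e`; upper columns `Uᵤ`
(signs `σᵤ ≠ 0` ARBITRARY, exponents `δᵤ > e`), lower columns `Uₗ` (signs `σₗ ≠ 0` arbitrary, exponents `δₗ < e`), with
NON-SINGULAR diagonal Gram blocks `Cᵤᵤ = UᵤᵀB⁻¹Uᵤ`, `Cₗₗ = UₗᵀB⁻¹Uₗ`.  Let `Z₊` be the number of positive zeros of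
`det(X^eB + Uᵤ diag(σᵤX^{δᵤ}) Uᵤᵀ + Uₗ diag(σₗX^{δₗ}) Uₗᵀ)` counted with multiplicity and
`Δ = (π(Cₗₗ) − #{σₗ > 0}) − (π(Cᵤᵤ) − #{σᵤ > 0})` the INERTIA DRIFT `ν(F(0⁺)) − ν(F(∞))`.  Then `Z₊ ≥ |Δ|` (both
one-sided inequalities, in `ℕ`) and `Z₊ ≡ Δ (mod 2)`. [folklore] -/
theorem drift_le_card_posRoots (B : Matrix ι ι ℝ) (hBs : B.IsSymm) (hBu : IsUnit B.det) (Uᵤ : Matrix ι ρᵤ ℝ)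
    (Uₗ : Matrix ι ρₗ ℝ) (σᵤ : ρᵤ → ℝ) (σₗ : ρₗ → ℝ) (hσᵤ : ∀ j, σᵤ j ≠ 0) (hσₗ : ∀ j, σₗ j ≠ 0) (e : ℕ)
    (δᵤ : ρᵤ → ℕ) (δₗ : ρₗ → ℕ) (hδᵤ : ∀ j, e < δᵤ j) (hδₗ : ∀ j, δₗ j < e) (hCᵤu : IsUnit (Uᵤᵀ * B⁻¹ * Uᵤ).det)
    (hCₗu : IsUnit (Uₗᵀ * B⁻¹ * Uₗ).det) (hCᵤ : (Uᵤᵀ * B⁻¹ * Uᵤ).IsHermitian) (hCₗ : (Uₗᵀ * B⁻¹ * Uₗ).IsHermitian) :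
    Fintype.card {j // 0 < hCₗ.eigenvalues j} + Fintype.card {j // 0 < σᵤ j}
        ≤ Fintype.card {j // 0 < hCᵤ.eigenvalues j} + Fintype.card {j // 0 < σₗ j}
          + Multiset.card ((Matrix.det (((Polynomial.X : Polynomial ℝ) ^ e) • B.map Polynomial.C + 𝕊[Uᵤ, σᵤ, δᵤ]
              + 𝕊[Uₗ, σₗ, δₗ])).roots.filter (fun t => 0 < t))
      ∧ Fintype.card {j // 0 < hCᵤ.eigenvalues j} + Fintype.card {j // 0 < σₗ j}
        ≤ Fintype.card {j // 0 < hCₗ.eigenvalues j} + Fintype.card {j // 0 < σᵤ j}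
          + Multiset.card ((Matrix.det (((Polynomial.X : Polynomial ℝ) ^ e) • B.map Polynomial.C + 𝕊[Uᵤ, σᵤ, δᵤ]
              + 𝕊[Uₗ, σₗ, δₗ])).roots.filter (fun t => 0 < t))
      ∧ Even (Fintype.card {j // 0 < hCₗ.eigenvalues j} + Fintype.card {j // 0 < σᵤ j}
          + Fintype.card {j // 0 < hCᵤ.eigenvalues j} + Fintype.card {j // 0 < σₗ j}
          + Multiset.card ((Matrix.det (((Polynomial.X : Polynomial ℝ) ^ e) • B.map Polynomial.C + 𝕊[Uᵤ, σᵤ, δᵤ]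
              + 𝕊[Uₗ, σₗ, δₗ])).roots.filter (fun t => 0 < t))) := by
  classical
  have hB : B.IsHermitian := Inertia.isHermitian_of_isSymm hBs
  -- option-pencil presentation of the juxtaposed word
  have hword : ((Polynomial.X : Polynomial ℝ) ^ e) • B.map Polynomial.C + 𝕊[Uᵤ, σᵤ, δᵤ] + 𝕊[Uₗ, σₗ, δₗ]
      = ((Polynomial.X : Polynomial ℝ) ^ e) • B.map Polynomial.C
        + 𝕊[Matrix.fromCols Uᵤ Uₗ, Sum.elim σᵤ σₗ, Sum.elim δᵤ δₗ] := by
    rw [add_assoc, ← signedPart_fromCols]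
  rw [hword, word_eq_optionPencil]
  set U := Matrix.fromCols Uᵤ Uₗ with hUdef
  set σ : ρᵤ ⊕ ρₗ → ℝ := Sum.elim σᵤ σₗ with hσdef
  set δ : ρᵤ ⊕ ρₗ → ℕ := Sum.elim δᵤ δₗ with hδdef
  set Sopt := (fun o : Option (ρᵤ ⊕ ρₗ) => Option.elim o B
    (fun j => σ j • Matrix.vecMulVec (fun a => U a j) (fun a => U a j))) with hSopt
  set dopt := (fun o : Option (ρᵤ ⊕ ρₗ) => Option.elim o e δ) with hdopt
  have hS : ∀ o, (Sopt o).IsSymm := isSymm_optionLetter hBs U σ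
  set P := Matrix.det (∑ o : Option (ρᵤ ⊕ ρₗ), ((Polynomial.X : Polynomial ℝ) ^ dopt o) • (Sopt o).map Polynomial.C)
    with hPdef
  -- the two ends
  obtain ⟨ε₀, hε₀, hε₀'⟩ := exists_negIndex_word_small' hBs hBu Uᵤ Uₗ hσᵤ hσₗ e hδᵤ hδₗ hB hCₗu hCₗ
  obtain ⟨N, hN, hN'⟩ := exists_negIndex_word_large' hBs hBu Uᵤ Uₗ hσᵤ hσₗ e hδᵤ hδₗ hB hCᵤu hCᵤ
  have hdetF : ∀ x : ℝ, (∑ k, x ^ dopt k • Sopt k).det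
      = (x ^ e • B + U * Matrix.diagonal (fun j => σ j * x ^ δ j) * Uᵀ).det := fun x => by
    rw [← eval_word_eq_optionPencil B U σ e δ x]
  have hνx : ∀ x : ℝ, Fintype.card {j // (Inertia.isHermitian_pencil dopt Sopt hS x).eigenvalues j < 0}
      = Fintype.card {j // (isHermitian_eval_word hBs U σ e δ x).eigenvalues j < 0} := fun x =>
    Inertia.negIndex_congr (Inertia.isHermitian_pencil dopt Sopt hS x) (isHermitian_eval_word hBs U σ e δ x)
      (eval_word_eq_optionPencil B U σ e δ x).symm
  have hcntx : ∀ x : ℝ, (∑ k, x ^ dopt k • Sopt k).det ≠ 0 →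
      Fintype.card {j // (Inertia.isHermitian_pencil dopt Sopt hS x).eigenvalues j < 0}
        + Fintype.card {j // 0 < (Inertia.isHermitian_pencil dopt Sopt hS x).eigenvalues j} = Fintype.card ι := by
    intro x hx
    have h := (Inertia.negIndex_add_posIndex_add_corank (Inertia.isHermitian_pencil dopt Sopt hS x)).1
    rw [Inertia.corank_eq_zero_of_det_ne_zero hx, add_zero] at h
    exact h
  by_cases hP0 : P = 0
  · exfalso
    have ha := (hε₀' (ε₀ / 2) (by positivity) (by linarith)).2
    apply ha
    rw [← hdetF, ← DefiniteMoments.eval_det_pencil, ← hPdef, hP0, Polynomial.eval_zero]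
  set a : ℝ := ε₀ / 2 with hadef
  set b : ℝ := N + 1 + (P.roots.toFinset.sum fun t => |t|) with hbdef
  have hapos : 0 < a := by rw [hadef]; positivity
  have hsumnn : 0 ≤ P.roots.toFinset.sum fun t => |t| := Finset.sum_nonneg fun t _ => abs_nonneg t
  have hNb : N ≤ b := by rw [hbdef]; linarith
  have hbpos : 0 < b := lt_of_lt_of_le hN hNb
  have hroot_lt_b : ∀ t ∈ P.roots, t < b := by
    intro t ht
    have hmem : t ∈ P.roots.toFinset := Multiset.mem_toFinset.2 ht
    have h1 : |t| ≤ P.roots.toFinset.sum fun t => |t| :=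
      Finset.single_le_sum (f := fun t => |t|) (fun t _ => abs_nonneg t) hmem
    have h2 : t ≤ |t| := le_abs_self t
    rw [hbdef]; linarith
  have hroot_ge : ∀ t ∈ P.roots, 0 < t → ε₀ ≤ t := by
    intro t ht hpos
    by_contra h
    push Not at h
    have hdet := (hε₀' t hpos h).2
    apply hdet
    rw [← hdetF, ← DefiniteMoments.eval_det_pencil, ← hPdef]
    exact (Polynomial.mem_roots hP0).1 ht
  have hb := hN' b hNb
  have hbdet : (∑ k, b ^ dopt k • Sopt k).det ≠ 0 := by rw [hdetF]; exact hb.2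
  rw [← hνx b] at hb
  rcases lt_or_ge a b with hab | hba
  swap
  · -- degenerate placement: both end formulas hold at `b`, and there is no positive root
    have hbε : b < ε₀ := lt_of_le_of_lt hba (by rw [hadef]; linarith)
    have hb' := hε₀' b hbpos hbε
    rw [← hνx b] at hb'
    have hnone : P.roots.filter (fun t => 0 < t) = 0 := by
      refine Multiset.filter_eq_nil.2 fun t ht hpos => ?_
      have h1 := hroot_ge t ht hpos
      have h2 := hroot_lt_b t ht
      linarith
    rw [hnone, Multiset.card_zero]
    refine ⟨by omega, by omega, ?_⟩
    rw [Nat.even_iff]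
    omega
  have ha := hε₀' a hapos (by rw [hadef]; linarith)
  have hadet : (∑ k, a ^ dopt k • Sopt k).det ≠ 0 := by rw [hdetF]; exact ha.2
  rw [← hνx a] at ha
  -- all positive roots lie in `(a, b)`, hence in `[a, b)`
  have hfilter : P.roots.filter (fun t => 0 < t) = P.roots.filter (fun t => a < t ∧ t < b) := by
    refine Multiset.filter_congr fun t ht => ⟨fun hpos' => ⟨?_, hroot_lt_b t ht⟩, fun h => lt_trans hapos h.1⟩
    have := hroot_ge t ht hpos'
    rw [hadef]; linarith
  have hle : Multiset.card (P.roots.filter (fun t => a ≤ t ∧ t < b))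
      ≤ Multiset.card (P.roots.filter (fun t => 0 < t)) :=
    Multiset.card_le_card (Multiset.monotone_filter_right P.roots fun t h => lt_of_lt_of_le hapos h.1)
  -- the window inequality (both indices) and the parity law
  have h1 := Inertia.pencil_negIndex_le_add_card_roots dopt Sopt hS hP0 hab.le
  have h2 := Inertia.pencil_posIndex_le_add_card_roots dopt Sopt hS hP0 hab.le
  have h3 := Inertia.even_negIndex_add_negIndex_add_card_roots dopt Sopt hS hab.le hadet hbdet
  rw [← hPdef] at h1 h2 h3
  rw [← hfilter] at h3
  have hca := hcntx a hadet
  have hcb := hcntx b hbdet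
  refine ⟨by omega, by omega, ?_⟩
  rw [Nat.even_iff] at h3 ⊢
  omega

omit [Fintype ι] [DecidableEq ι] [Fintype ρᵤ] [DecidableEq ρᵤ] [Fintype ρₗ] [DecidableEq ρₗ] in
/-- The signed column part of an EMPTY column system vanishes. [folklore] -/
theorem signedPart_pempty (U : Matrix ι PEmpty ℝ) (σ : PEmpty → ℝ) (δ : PEmpty → ℕ) : 𝕊[U, σ, δ] = 0 := by
  ext a b
  simp only [Matrix.mul_apply, Matrix.zero_apply, Finset.univ_eq_empty, Finset.sum_empty]

/-- **THE ONE-SIDED DRIFT LAW (arbitrary signs).**  `B` real symmetric, `det B ≠ 0`; columns `uⱼ` with signs `σⱼ ≠ 0` of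
ANY sign, all at exponents `δⱼ > e`, with NON-SINGULAR Gram matrix `C = UᵀB⁻¹U`.  Then the positive zeros `Z₊` of
`det(X^eB + U diag(σX^δ) Uᵀ)` counted with multiplicity satisfy `Z₊ ≥ |π(C) − #{σ > 0}|` and `Z₊ ≡ π(C) + #{σ > 0} (mod 2)`
(for `σ > 0` this is `ν(C) ≤ Z₊ ≡ ν(C)`, consistent with the exact one-sided rung `Z₊ = ν(C)`). [folklore] -/
theorem oneSided_drift_le_card_posRoots (B : Matrix ι ι ℝ) (hBs : B.IsSymm) (hBu : IsUnit B.det) (U : Matrix ι ρᵤ ℝ)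
    (σ : ρᵤ → ℝ) (hσ : ∀ j, σ j ≠ 0) (e : ℕ) (δ : ρᵤ → ℕ) (hδ : ∀ j, e < δ j) (hCu : IsUnit (Uᵀ * B⁻¹ * U).det)
    (hC : (Uᵀ * B⁻¹ * U).IsHermitian) :
    Fintype.card {j // 0 < σ j}
        ≤ Fintype.card {j // 0 < hC.eigenvalues j}
          + Multiset.card ((Matrix.det (((Polynomial.X : Polynomial ℝ) ^ e) • B.map Polynomial.C + 𝕊[U, σ, δ])).roots.filter
              (fun t => 0 < t))
      ∧ Fintype.card {j // 0 < hC.eigenvalues j}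
        ≤ Fintype.card {j // 0 < σ j}
          + Multiset.card ((Matrix.det (((Polynomial.X : Polynomial ℝ) ^ e) • B.map Polynomial.C + 𝕊[U, σ, δ])).roots.filter
              (fun t => 0 < t))
      ∧ Even (Fintype.card {j // 0 < σ j} + Fintype.card {j // 0 < hC.eigenvalues j}
          + Multiset.card ((Matrix.det (((Polynomial.X : Polynomial ℝ) ^ e) • B.map Polynomial.C + 𝕊[U, σ, δ])).roots.filter
              (fun t => 0 < t))) := by
  classical
  set Uₗ : Matrix ι PEmpty ℝ := 0 with hUₗ
  set σₗ : PEmpty → ℝ := fun j => 1 with hσₗ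
  set δₗ : PEmpty → ℕ := fun j => 0 with hδₗ
  have hCₗ : (Uₗᵀ * B⁻¹ * Uₗ).IsHermitian := isHermitian_gram hBs Uₗ
  have hCₗu : IsUnit (Uₗᵀ * B⁻¹ * Uₗ).det := by rw [Matrix.det_isEmpty]; exact isUnit_one
  -- the lower block is vacuous on `PEmpty`
  have h := drift_le_card_posRoots B hBs hBu U Uₗ σ σₗ hσ (fun j => j.elim) e δ δₗ hδ (fun j => j.elim) hCu hCₗu hC
    hCₗ
  rw [signedPart_pempty, add_zero] at h
  have h0 : Fintype.card {j : PEmpty // 0 < hCₗ.eigenvalues j} = 0 := Fintype.card_eq_zero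
  have h0' : Fintype.card {j : PEmpty // 0 < σₗ j} = 0 := Fintype.card_eq_zero
  rw [h0, h0'] at h
  simp only [zero_add, add_zero] at h
  exact h

end Drift

end GramDual

end Summit.ValiantsHypothesis.ValiantsHypothesis.Theorems.LacunarySymmetroidMatrixDescartes
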